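import Summits.HodgeConjecture.HodgeConjecture.Theorems.F0P2oJacquetTwistSwapChart           -- ★ p834408: `r_N(X_v) ≃ Coinv σ χ_{f,v}` through a chart
import Literature.RepresentationTheory.TwistedCoinvariantsCompactIsotypic                    -- ★ `TwistedCoinv.exists_linearEquiv_weightSpace_coinv`
import Literature.NumberTheory.Automorphic.UnitaryGroupNonsplitTorus                         -- ★ `isOpen_ker_of_smul_eq`
import Literature.NumberTheory.Automorphic.Liu2021.Def411WeilCarriersSurvivalNonsplit        -- ★ `compactSpace_localPi_one_of_smul_eq`, `continuous_localCenter`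
import HarnessLib

/-!
# Crux `H413`, programme P2, N3 road (a) — LETTER (a) FROM THE (S5) DICTIONARY
# (`r_N(X_v) ≃ₗ[ℂ] ℱ_v[ψθ]` as soon as one Jacquet chart carries the descended centre action to a scalar twist of `ω¹(γ_v, ψ_v)`)

Cell hodgecm-mathlib (D-0151), FLOOR 0, crux item H413 = stmt-HodgeConjecture-24833, programme P2; N3 road notes
`F0/P2/B-p18/g28/N3-ROAD.v1∕v2.B-p18g28.md` (K1 lead B-p18 (g28)), v2 §1 «(a) = (S4) ∘ CM CLOSER ∘ (S5) — an M assembler file»; seat A-p12 (g17).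
THIS IS THAT ASSEMBLER: it reduces letter (a) of the printed named fact ★ `GelbartRogawski1991.thetaType_nonsplit_jacquetModule`
(«`r_N(X_v) ≃ ℱ_v[ψθ]`» [GelbartRogawski1991 §3.2 p. 457; Kudla1986 Thm. 2.8]) to ONE hypothesis, the (S5) DICTIONARY, everything else being ★:
★ p834408 `F0P2oJacquetTwistSwapChart.nonempty_jacquet_xThetaGqsCM_equiv_of_chart` (`r_N(X_v) ≃ Coinv σ χ_{f,v}` for every Jacquet chart `(π, σ)`),
★ `Literature.RepresentationTheory.TwistedCoinv.mapEquiv` (functoriality of twisted coinvariants along a linear isomorphism with a scalar twist),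
★ `TwistedCoinv.exists_linearEquiv_weightSpace_coinv` (compact-group dictionary «isotypic quotient = isotypic subspace»), ★ `compactSpace_localPi_one_of_smul_eq`
∕ ★ `isOpen_ker_of_smul_eq` (`E¹_v` compact at non-split `v`; continuous characters have open kernel), ★ `FinLocalSplittings.isSmooth_omegaLoc` ∕
★ `continuous_localCenter` (`ω¹` is smooth on `U((ε))(L⁺_v)`).

WHAT IS PROVED (kernel, no `sorry`, axioms the standard trio).
* `isSmooth_comp_of_continuous` — smoothness is preserved along a continuous homomorphism (generic).
* **`nonempty_jacquet_xThetaGqsCM_equiv_weightSpace_of_dictionary`** — for `v` non-split (`hv`), a form congruence `(T, a, h)`, a character `ψθ` of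
  `E¹_v` with `ψθ ∘ det ∘ localPiEquiv` continuous (`hψc`), a Jacquet chart `(π, σ)` of `ω_v ∘ localLineInl ∘ localPiEquiv⁻¹ ∘ cmDatumLocalCongr T` along
  `(cmBorelTriple L 3 v).N` (`hπ`, `hker`, `hσ` — the hypotheses of ★ p834408, same spelling), and a DICTIONARY `(Tr : S₁ ≃ₗ[ℂ] 𝒮(Fin n₀ → L⁺_v), c)` with
  `lineWeilCM … u (Tr s) = c(u) • Tr (σ u s)` (`hTr`) and `ψθ(det u) = c(u) · χ_{f,v}(u)` (`hχ`):
  `Nonempty (((cmBorelTriple L 3 v).restrict (xThetaGqsCM L e₁ dV hdV hdV0 μ hμ χf ε v T ha h)).Coinvariants ≃ₗ[ℂ]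
  ↥(weightSpace (lineWeilCM L e₀ (kernelLineCM dV) … μ hμ ε v) id (fun u => ψθ (localDet … (localPiEquiv … u)))))` — BOTH sides are letter (a)'s,
  token for token.
* **`nonempty_jacquet_xThetaGqsCM_equiv_weightSpace_of_thetaCenterChar`** — the same at the datum's character: with ★ `IsThetaCenterChar L μ χf ε v ψθ`
  (`ψθ(det u) = χ_{f,v}(u) μ_v(det u)⁻¹`) the dictionary scalar is `c(u) = μ_v(det u)⁻¹`, i.e. the hypothesis reads
  «`ω¹(u) (Tr s) = μ_v(det u)⁻¹ • Tr (σ u s)`» — print's «`d(β, β, β)` acts on `ℱ_v` by `γ_v(β) ω¹(β)`» [p. 457 (3.2.1)–(3.2.2); p. 467 L25–27].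

WHAT REMAINS FOR LETTER (a) = EXACTLY the binders `(π, hπ, hker, σ, hσ, Tr, hTr)` of the second theorem (plus `hψc`, which the final assembler gets from
`Continuous χf` and the continuity of `μ_v ∘ det`): ONE Jacquet chart of `ω_v|` onto `𝒮(Fin n₀ → L⁺_v)` on which the centre `u·1₃` of `U(V)(L⁺_v)` acts as
`μ_v(det u) · ω¹(u)` — road v2 §1 (S5) with §2 (D1)–(D3) for the scalar.  Charts onto `𝒮(Fin 1 → L⁺_v)` EXIST unconditionally (★ p834408
`exists_chart_nonempty_jacquet_xThetaGqsCM_equiv`); the content is the identification of `σ`.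
[GelbartRogawski1991 §3.2 (3.2.1)–(3.2.3) p. 457, §5.2 p. 467; Kudla1986 Thm. 2.8; MoeglinVignerasWaldspurger1987 Chap. 3 §IV.4–5; BernsteinZelevinsky1976 §2.1, §2.3;
Rogawski1990 §12.2 (2) p. 174.]

## References
* [GelbartRogawski1991] S. Gelbart, J. Rogawski, *L-functions and Fourier–Jacobi coefficients for the unitary group U(3)*, Invent. Math. 105 (1991):
  §3.2 (3.2.1)–(3.2.3) p. 457; §5.2 p. 467 L8–11, L25–27.
* [Kudla1986] S. Kudla, *On the local theta-correspondence*, Invent. Math. 83 (1986): Thm. 2.8.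
* [MoeglinVignerasWaldspurger1987] C. Mœglin, M.-F. Vignéras, J.-L. Waldspurger, *Correspondances de Howe sur un corps p-adique*, LNM 1291 (1987): Chap. 3 §IV.4, §IV.5.
* [BernsteinZelevinsky1976] I. N. Bernstein, A. V. Zelevinsky, *Representations of the group GL(n, F) …*, Russian Math. Surveys 31 (1976): §2.1, §2.3.
* [Rogawski1990] J. Rogawski, *Automorphic representations of unitary groups in three variables*, Ann. of Math. Stud. 123 (1990): §12.2 (2) p. 174.
-/

set_option autoImplicit false
set_option linter.dupNamespace false -- the mandated namespace repeats the single-problem summit's segment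

noncomputable section

open NumberField IsDedekindDomain
open scoped Matrix Kronecker
open Literature.RepresentationTheory Literature.NumberTheory.Automorphic Representation
open Literature.NumberTheory Literature.NumberTheory.Automorphic.UnitaryGroup
open Literature.NumberTheory.Automorphic.IdeleClassGroup
open Literature.NumberTheory.Automorphic.Liu2021 Literature.NumberTheory.Automorphic.Liu2021.Def411WeilCarriers
open Literature.NumberTheory.GelbartRogawski1991 Literature.NumberTheory.GelbartRogawski1991.UnitaryDualPair
open Literature.NumberTheory.GelbartRogawski1991.UnitaryDualPair.WeilCoinv Literature.NumberTheory.GelbartRogawski1991.UnitaryDualPair.LocalSplitting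
open Literature.NumberTheory.GaloisRepresentations Literature.NumberTheory.Rogawski1990
open Literature.RepresentationTheory.Liu2021 Literature.RepresentationTheory.HeisenbergGroup
open Summit.HodgeConjecture.HodgeConjecture.Cruxes.H413.F0P2oJacquetTwistSwapChart

namespace Summit.HodgeConjecture.HodgeConjecture.Cruxes.H413.F0P2oThetaTypeJacquetWeightSpaceOfDictionary

/-! ## §1 Generic: smoothness along a continuous homomorphism -/

/-- a smooth representation stays smooth when read along a continuous homomorphism (the stabiliser of `v` for `ρ ∘ φ` is the preimage of
its stabiliser for `ρ`). [cite: BernsteinZelevinsky1976, §2.1] -/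
theorem isSmooth_comp_of_continuous {k G H V : Type*} [CommRing k] [Group G] [Group H] [TopologicalSpace G] [TopologicalSpace H]
    [AddCommGroup V] [Module k V] (ρ : Representation k G V) (hρ : ρ.IsSmooth) (φ : H →* G) (hφ : Continuous φ) :
    Representation.IsSmooth (ρ.comp φ) := fun v =>
  (hρ v).preimage hφ

/-! ## §2 Letter (a) from a dictionary chart -/

variable (L : Type) [Field L] [NumberField L] [IsCMField L]

set_option synthInstance.maxHeartbeats 400000 in
set_option maxHeartbeats 8000000 in
/-- **LETTER (a) OF ★ `thetaType_nonsplit_jacquetModule` FROM THE (S5) DICTIONARY.**  At a place `v` of `L⁺` not split in `L` (`hv`), for a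
form congruence `(T, a, h)` reading `X_v(μ, ε, χ_f)` on `U(Φ₃)(L⁺_v)` (★ `xThetaGqsCM`) and a character `ψθ` of `E¹_v` continuous on
`U((ε))(L⁺_v)` (`hψc`): IF a Jacquet chart `(π, σ)` of `ω_v ∘ localLineInl ∘ localPiEquiv⁻¹ ∘ cmDatumLocalCongr T` along `N` (onto, `ker π` the
relation submodule, `σ` the descended centre action) is carried by a linear isomorphism `Tr : S₁ ≃ 𝒮(Fin n₀ → L⁺_v)` onto a SCALAR TWIST of GR's
rank-one oscillator representation ★ `lineWeilCM L e₀ (kernelLineCM dV) … μ hμ ε v` — `ω¹(u) (Tr s) = c(u) • Tr (σ u s)` (`hTr`) with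
`ψθ(det u) = c(u) · χ_{f,v}(u)` (`hχ`; for the datum's `ψθ = χ_{f,v} μ_v⁻¹` of ★ `IsThetaCenterChar` this is `c = μ_v⁻¹ ∘ det`, road note v2 §2) — THEN
**`Nonempty (r_N(X_v) ≃ₗ[ℂ] ℱ_v[ψθ])`** with the letter's right-hand side token for token (★ `weightSpace (lineWeilCM …) id (ψθ ∘ localDet ∘ localPiEquiv)`).
Assembly: ★ p834408 `nonempty_jacquet_xThetaGqsCM_equiv_of_chart` (`r_N(X_v) ≃ Coinv σ χ_{f,v}`) ∘ ★ `TwistedCoinv.mapEquiv` along `(Tr, c)`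
(`Coinv σ χ_{f,v} ≃ Coinv ω¹ ψθ`) ∘ ★ `TwistedCoinv.exists_linearEquiv_weightSpace_coinv` (compact `E¹_v`: ★ `compactSpace_localPi_one_of_smul_eq`;
`ω¹` smooth: ★ `FinLocalSplittings.isSmooth_omegaLoc` along ★ `continuous_localCenter`; `ker ψθ` open: ★ `isOpen_ker_of_smul_eq`).
[cite: GelbartRogawski1991, §3.2 (3.2.1)–(3.2.3) p. 457; §5.2 p. 467 L8–11, L25–27] [cite: Kudla1986, Thm. 2.8]
[cite: MoeglinVignerasWaldspurger1987, Chap. 3 §IV.4, §IV.5] [cite: BernsteinZelevinsky1976, §2.3] -/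
theorem nonempty_jacquet_xThetaGqsCM_equiv_weightSpace_of_dictionary {n' : ℕ} (e₁ : Fin 3 × Fin 1 ≃ Fin n') (dV : Fin 3 → L)
    (hdV : ∀ i, IsCMField.complexConj L (dV i) = dV i) (hdV0 : ∀ i, dV i ≠ 0) {n₀ : ℕ} (e₀ : Fin 1 × Fin 1 ≃ Fin n₀)
    (μ : Literature.NumberTheory.Automorphic.IdeleClassGroup L →ₜ* Circle) (hμ : IsConjugateSymplectic L μ)
    (χf : UnitaryGroup.finAdelicOne (↥(maximalRealSubfield L)) L (IsCMField.complexConj L) →* ℂˣ) (ε : (↥(maximalRealSubfield L))ˣ)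
    (v : HeightOneSpectrum (𝓞 ↥(maximalRealSubfield L))) (hv : ∀ w : PlacesOver L v, IsCMField.complexConj L • w.1 = w.1)
    (ψθ : ↥(normOneUnits (conjLocal L (IsCMField.complexConj L) v)) →* ℂˣ)
    (hψc : Continuous fun u : localPi L (IsCMField.complexConj L) 1 (JW (↥(maximalRealSubfield L)) L ε) v =>
      ((ψθ (localDet (IsCMField.complexConj L) v
        (isUnit_iff_ne_zero.mpr (by rw [Matrix.det_fin_one]; exact JW_apply_ne_zero (↥(maximalRealSubfield L)) L ε))
        (localPiEquiv L (IsCMField.complexConj L) 1 (JW (↥(maximalRealSubfield L)) L ε) v u)) : ℂˣ) : ℂ))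
    (T : GL (Fin 3) (UnitaryGroup.LocalRing L v)) {a : UnitaryGroup.LocalRing L v} (ha : IsUnit a)
    (h : formCongr (conjLocal L (IsCMField.complexConj L) v) T ((Matrix.diagonal dV).map (algebraMap L (UnitaryGroup.LocalRing L v))) =
      a • (Matrix.of fun i j : Fin 3 => if i.val + j.val + 1 = 3 then (1 : L) else 0).map (algebraMap L (UnitaryGroup.LocalRing L v)))
    -- the dictionary chart
    {S₁ : Type*} [AddCommGroup S₁] [Module ℂ S₁]
    (π : SchwartzBruhat (Fin n' → v.adicCompletion ↥(maximalRealSubfield L)) →ₗ[ℂ] S₁) (hπ : Function.Surjective π)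
    (hker : LinearMap.ker π = Coinvariants.ker
      (((((chiLocalSplittingsCM L e₁ dV hdV hdV0 (toHeckeCharacter L μ) ((isOscillatorChar_toHeckeCharacter_iff μ).mpr hμ) ε).omegaLoc v).comp
        (localLineInl L (IsCMField.complexConj L) 3 e₁ (Matrix.diagonal dV) (JW (↥(maximalRealSubfield L)) L ε) v)).comp
        ((localPiEquiv L (IsCMField.complexConj L) 3 (Matrix.diagonal dV) v).symm.toMulEquiv.toMonoidHom.comp
          (cmDatumLocalCongr L v T ha h : Gqs L v ≃ₜ* (cmDatum L 3 (Matrix.diagonal dV)).Local v).toMulEquiv.toMonoidHom)).comp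
        (cmBorelTriple L 3 v).N.subtype))
    (σ : Representation ℂ (localPi L (IsCMField.complexConj L) 1 (JW (↥(maximalRealSubfield L)) L ε) v) S₁)
    (hσ : ∀ (u : localPi L (IsCMField.complexConj L) 1 (JW (↥(maximalRealSubfield L)) L ε) v)
      (f : SchwartzBruhat (Fin n' → v.adicCompletion ↥(maximalRealSubfield L))),
      π ((chiLocalSplittingsCM L e₁ dV hdV hdV0 (toHeckeCharacter L μ) ((isOscillatorChar_toHeckeCharacter_iff μ).mpr hμ) ε).omegaLoc v
        (localCenter L (IsCMField.complexConj L) n' (Matrix.reindex e₁ e₁ (Matrix.diagonal dV ⊗ₖ JW (↥(maximalRealSubfield L)) L ε))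
          (JW (↥(maximalRealSubfield L)) L ε) (JW_apply_ne_zero (↥(maximalRealSubfield L)) L ε) v u) f) = σ u (π f))
    (Tr : S₁ ≃ₗ[ℂ] SchwartzBruhat (Fin n₀ → v.adicCompletion ↥(maximalRealSubfield L)))
    (c : localPi L (IsCMField.complexConj L) 1 (JW (↥(maximalRealSubfield L)) L ε) v → ℂˣ)
    (hTr : ∀ (u : localPi L (IsCMField.complexConj L) 1 (JW (↥(maximalRealSubfield L)) L ε) v) (s : S₁),
      lineWeilCM L e₀ (kernelLineCM dV) (complexConj_kernelLineCM dV hdV) (kernelLineCM_ne_zero dV hdV0) μ hμ ε v u (Tr s) =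
        ((c u : ℂˣ) : ℂ) • Tr (σ u s))
    (hχ : ∀ u : localPi L (IsCMField.complexConj L) 1 (JW (↥(maximalRealSubfield L)) L ε) v,
      ψθ (localDet (IsCMField.complexConj L) v
        (isUnit_iff_ne_zero.mpr (by rw [Matrix.det_fin_one]; exact JW_apply_ne_zero (↥(maximalRealSubfield L)) L ε))
        (localPiEquiv L (IsCMField.complexConj L) 1 (JW (↥(maximalRealSubfield L)) L ε) v u)) =
      c u * localCharOfCenter (↥(maximalRealSubfield L)) L (IsCMField.complexConj L) (JW (↥(maximalRealSubfield L)) L ε)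
        (JW_apply_ne_zero (↥(maximalRealSubfield L)) L ε) χf v u) :
    Nonempty (((cmBorelTriple L 3 v).restrict (xThetaGqsCM L e₁ dV hdV hdV0 μ hμ χf ε v T ha h)).Coinvariants ≃ₗ[ℂ]
      ↥(weightSpace (lineWeilCM L e₀ (kernelLineCM dV) (complexConj_kernelLineCM dV hdV) (kernelLineCM_ne_zero dV hdV0) μ hμ ε v) id
        (fun u => ((ψθ (localDet (IsCMField.complexConj L) v
          (isUnit_iff_ne_zero.mpr (by rw [Matrix.det_fin_one]; exact JW_apply_ne_zero (↥(maximalRealSubfield L)) L ε))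
          (localPiEquiv L (IsCMField.complexConj L) 1 (JW (↥(maximalRealSubfield L)) L ε) v u)) : ℂˣ) : ℂ)))) := by
  -- (1) ★ p834408: `r_N(X_v) ≃ Coinv σ χ_{f,v}`
  obtain ⟨eJ⟩ := nonempty_jacquet_xThetaGqsCM_equiv_of_chart L e₁ dV hdV hdV0 μ hμ χf ε v T ha h π hπ hker σ hσ
  -- the character `ψθ ∘ det ∘ localPiEquiv` of `U((ε))(L⁺_v)` as a homomorphism (opaque local, with its defining equation)
  obtain ⟨ψ, hψ⟩ : ∃ ψ : localPi L (IsCMField.complexConj L) 1 (JW (↥(maximalRealSubfield L)) L ε) v →* ℂˣ, ∀ u,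
      ψ u = ψθ (localDet (IsCMField.complexConj L) v
        (isUnit_iff_ne_zero.mpr (by rw [Matrix.det_fin_one]; exact JW_apply_ne_zero (↥(maximalRealSubfield L)) L ε))
        (localPiEquiv L (IsCMField.complexConj L) 1 (JW (↥(maximalRealSubfield L)) L ε) v u)) :=
    ⟨(ψθ.comp (localDet (IsCMField.complexConj L) v
        (isUnit_iff_ne_zero.mpr (by rw [Matrix.det_fin_one]; exact JW_apply_ne_zero (↥(maximalRealSubfield L)) L ε)))).comp
      (localPiEquiv L (IsCMField.complexConj L) 1 (JW (↥(maximalRealSubfield L)) L ε) v).toMonoidHom, fun _ => rfl⟩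
  -- (2) re-twist along the dictionary: `Coinv σ χ_{f,v} ≃ Coinv ω¹ ψ` (★ `TwistedCoinv.mapEquiv` with `T := Tr`, `e := c`)
  have hχ' : ∀ u, ψ u = c u * localCharOfCenter (↥(maximalRealSubfield L)) L (IsCMField.complexConj L) (JW (↥(maximalRealSubfield L)) L ε)
      (JW_apply_ne_zero (↥(maximalRealSubfield L)) L ε) χf v u := fun u => by rw [hψ, hχ]
  let eT := TwistedCoinv.mapEquiv σ
    (localCharOfCenter (↥(maximalRealSubfield L)) L (IsCMField.complexConj L) (JW (↥(maximalRealSubfield L)) L ε)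
      (JW_apply_ne_zero (↥(maximalRealSubfield L)) L ε) χf v)
    (lineWeilCM L e₀ (kernelLineCM dV) (complexConj_kernelLineCM dV hdV) (kernelLineCM_ne_zero dV hdV0) μ hμ ε v) ψ Tr c hTr hχ'
  -- (3) the compact-group dictionary `weightSpace ω¹ ψ ≃ Coinv ω¹ ψ`: `E¹_v` compact (non-split `v`), `ω¹` smooth, `ker ψ` open
  obtain ⟨w⟩ := (inferInstance : Nonempty (PlacesOver L v))
  haveI : CompactSpace (localPi L (IsCMField.complexConj L) 1 (JW (↥(maximalRealSubfield L)) L ε) v) :=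
    compactSpace_localPi_one_of_smul_eq (IsCMField.complexConj L) (JW (↥(maximalRealSubfield L)) L ε) (IsCMField.complexConj_ne_one L)
      (JW_apply_ne_zero (↥(maximalRealSubfield L)) L ε) w (hv w)
  have hopen : IsOpen ((ψ.ker : Subgroup (localPi L (IsCMField.complexConj L) 1 (JW (↥(maximalRealSubfield L)) L ε) v)) :
      Set (localPi L (IsCMField.complexConj L) 1 (JW (↥(maximalRealSubfield L)) L ε) v)) := by
    refine isOpen_ker_of_smul_eq (IsCMField.complexConj L) (JW (↥(maximalRealSubfield L)) L ε) (IsCMField.complexConj_ne_one L)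
      (JW_apply_ne_zero (↥(maximalRealSubfield L)) L ε) w (hv w) ψ (hψc.congr fun u => ?_)
    rw [hψ]
  have hsm : Representation.IsSmooth
      (lineWeilCM L e₀ (kernelLineCM dV) (complexConj_kernelLineCM dV hdV) (kernelLineCM_ne_zero dV hdV0) μ hμ ε v) :=
    isSmooth_comp_of_continuous _
      ((lineSplittingsCM L e₀ (kernelLineCM dV) (complexConj_kernelLineCM dV hdV) (kernelLineCM_ne_zero dV hdV0) (toHeckeCharacter L μ)
        ((isOscillatorChar_toHeckeCharacter_iff μ).mpr hμ) ε).isSmooth_omegaLoc v) _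
      (continuous_localCenter L (IsCMField.complexConj L) n₀ _ (JW (↥(maximalRealSubfield L)) L ε)
        (JW_apply_ne_zero (↥(maximalRealSubfield L)) L ε) v)
  obtain ⟨eW, -⟩ := TwistedCoinv.exists_linearEquiv_weightSpace_coinv
    (lineWeilCM L e₀ (kernelLineCM dV) (complexConj_kernelLineCM dV hdV) (kernelLineCM_ne_zero dV hdV0) μ hμ ε v) ψ hsm hopen
  -- the weight function of the letter is `ψ`'s, pointwise
  have hwt : (fun u : localPi L (IsCMField.complexConj L) 1 (JW (↥(maximalRealSubfield L)) L ε) v => ((ψ u : ℂˣ) : ℂ)) =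
      fun u => ((ψθ (localDet (IsCMField.complexConj L) v
        (isUnit_iff_ne_zero.mpr (by rw [Matrix.det_fin_one]; exact JW_apply_ne_zero (↥(maximalRealSubfield L)) L ε))
        (localPiEquiv L (IsCMField.complexConj L) 1 (JW (↥(maximalRealSubfield L)) L ε) v u)) : ℂˣ) : ℂ) :=
    funext fun u => by rw [hψ]
  rw [hwt] at eW
  exact ⟨eJ.trans (eT.trans eW.symm)⟩

set_option synthInstance.maxHeartbeats 400000 in
set_option maxHeartbeats 8000000 in
/-- **LETTER (a) FROM THE (S5) DICTIONARY AT THE DATUM'S CHARACTER `ψθ = χ_{f,v} μ_v⁻¹`** (★ `IsThetaCenterChar L μ χf ε v ψθ`): the scalar of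
the dictionary is then `c(u) = μ_v(det u)⁻¹` — «`d(β, β, β)` acts on `ℱ_v` by `γ_v(β) ω¹(β)`» [GelbartRogawski1991 p. 457 (3.2.1)–(3.2.2), p. 467 L25–27]
— and the conclusion is letter (a) of ★ `thetaType_nonsplit_jacquetModule` for this `(L, e₁, dV, e₀, μ, χ_f, v, ε, ψθ, T, a, h)`, token for token.
[cite: GelbartRogawski1991, §3.2 (3.2.1)–(3.2.2) p. 457; proof of Prop. 5.2.1 p. 467 L25–27] [cite: Kudla1986, Thm. 2.8] [cite: Rogawski1990, §12.2 (2) p. 174] -/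
theorem nonempty_jacquet_xThetaGqsCM_equiv_weightSpace_of_thetaCenterChar {n' : ℕ} (e₁ : Fin 3 × Fin 1 ≃ Fin n') (dV : Fin 3 → L)
    (hdV : ∀ i, IsCMField.complexConj L (dV i) = dV i) (hdV0 : ∀ i, dV i ≠ 0) {n₀ : ℕ} (e₀ : Fin 1 × Fin 1 ≃ Fin n₀)
    (μ : Literature.NumberTheory.Automorphic.IdeleClassGroup L →ₜ* Circle) (hμ : IsConjugateSymplectic L μ)
    (χf : UnitaryGroup.finAdelicOne (↥(maximalRealSubfield L)) L (IsCMField.complexConj L) →* ℂˣ) (ε : (↥(maximalRealSubfield L))ˣ)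
    (v : HeightOneSpectrum (𝓞 ↥(maximalRealSubfield L))) (hv : ∀ w : PlacesOver L v, IsCMField.complexConj L • w.1 = w.1)
    (ψθ : ↥(normOneUnits (conjLocal L (IsCMField.complexConj L) v)) →* ℂˣ) (hψθ : IsThetaCenterChar L μ χf ε v ψθ)
    (hψc : Continuous fun u : localPi L (IsCMField.complexConj L) 1 (JW (↥(maximalRealSubfield L)) L ε) v =>
      ((ψθ (localDet (IsCMField.complexConj L) v
        (isUnit_iff_ne_zero.mpr (by rw [Matrix.det_fin_one]; exact JW_apply_ne_zero (↥(maximalRealSubfield L)) L ε))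
        (localPiEquiv L (IsCMField.complexConj L) 1 (JW (↥(maximalRealSubfield L)) L ε) v u)) : ℂˣ) : ℂ))
    (T : GL (Fin 3) (UnitaryGroup.LocalRing L v)) {a : UnitaryGroup.LocalRing L v} (ha : IsUnit a)
    (h : formCongr (conjLocal L (IsCMField.complexConj L) v) T ((Matrix.diagonal dV).map (algebraMap L (UnitaryGroup.LocalRing L v))) =
      a • (Matrix.of fun i j : Fin 3 => if i.val + j.val + 1 = 3 then (1 : L) else 0).map (algebraMap L (UnitaryGroup.LocalRing L v)))
    {S₁ : Type*} [AddCommGroup S₁] [Module ℂ S₁]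
    (π : SchwartzBruhat (Fin n' → v.adicCompletion ↥(maximalRealSubfield L)) →ₗ[ℂ] S₁) (hπ : Function.Surjective π)
    (hker : LinearMap.ker π = Coinvariants.ker
      (((((chiLocalSplittingsCM L e₁ dV hdV hdV0 (toHeckeCharacter L μ) ((isOscillatorChar_toHeckeCharacter_iff μ).mpr hμ) ε).omegaLoc v).comp
        (localLineInl L (IsCMField.complexConj L) 3 e₁ (Matrix.diagonal dV) (JW (↥(maximalRealSubfield L)) L ε) v)).comp
        ((localPiEquiv L (IsCMField.complexConj L) 3 (Matrix.diagonal dV) v).symm.toMulEquiv.toMonoidHom.comp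
          (cmDatumLocalCongr L v T ha h : Gqs L v ≃ₜ* (cmDatum L 3 (Matrix.diagonal dV)).Local v).toMulEquiv.toMonoidHom)).comp
        (cmBorelTriple L 3 v).N.subtype))
    (σ : Representation ℂ (localPi L (IsCMField.complexConj L) 1 (JW (↥(maximalRealSubfield L)) L ε) v) S₁)
    (hσ : ∀ (u : localPi L (IsCMField.complexConj L) 1 (JW (↥(maximalRealSubfield L)) L ε) v)
      (f : SchwartzBruhat (Fin n' → v.adicCompletion ↥(maximalRealSubfield L))),
      π ((chiLocalSplittingsCM L e₁ dV hdV hdV0 (toHeckeCharacter L μ) ((isOscillatorChar_toHeckeCharacter_iff μ).mpr hμ) ε).omegaLoc v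
        (localCenter L (IsCMField.complexConj L) n' (Matrix.reindex e₁ e₁ (Matrix.diagonal dV ⊗ₖ JW (↥(maximalRealSubfield L)) L ε))
          (JW (↥(maximalRealSubfield L)) L ε) (JW_apply_ne_zero (↥(maximalRealSubfield L)) L ε) v u) f) = σ u (π f))
    (Tr : S₁ ≃ₗ[ℂ] SchwartzBruhat (Fin n₀ → v.adicCompletion ↥(maximalRealSubfield L)))
    (hTr : ∀ (u : localPi L (IsCMField.complexConj L) 1 (JW (↥(maximalRealSubfield L)) L ε) v) (s : S₁),
      lineWeilCM L e₀ (kernelLineCM dV) (complexConj_kernelLineCM dV hdV) (kernelLineCM_ne_zero dV hdV0) μ hμ ε v u (Tr s) =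
        ((((toHeckeCharacter L μ).semilocalComponent L v
          ((localDet (IsCMField.complexConj L) v
            (isUnit_iff_ne_zero.mpr (by rw [Matrix.det_fin_one]; exact JW_apply_ne_zero (↥(maximalRealSubfield L)) L ε))
            (localPiEquiv L (IsCMField.complexConj L) 1 (JW (↥(maximalRealSubfield L)) L ε) v u) :
              ↥(normOneUnits (conjLocal L (IsCMField.complexConj L) v))) : (UnitaryGroup.LocalRing L v)ˣ))⁻¹ : ℂˣ) : ℂ) • Tr (σ u s)) :
    Nonempty (((cmBorelTriple L 3 v).restrict (xThetaGqsCM L e₁ dV hdV hdV0 μ hμ χf ε v T ha h)).Coinvariants ≃ₗ[ℂ]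
      ↥(weightSpace (lineWeilCM L e₀ (kernelLineCM dV) (complexConj_kernelLineCM dV hdV) (kernelLineCM_ne_zero dV hdV0) μ hμ ε v) id
        (fun u => ((ψθ (localDet (IsCMField.complexConj L) v
          (isUnit_iff_ne_zero.mpr (by rw [Matrix.det_fin_one]; exact JW_apply_ne_zero (↥(maximalRealSubfield L)) L ε))
          (localPiEquiv L (IsCMField.complexConj L) 1 (JW (↥(maximalRealSubfield L)) L ε) v u)) : ℂˣ) : ℂ)))) :=
  nonempty_jacquet_xThetaGqsCM_equiv_weightSpace_of_dictionary L e₁ dV hdV hdV0 e₀ μ hμ χf ε v hv ψθ hψc T ha h π hπ hker σ hσ Tr _ hTr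
    fun u => by rw [hψθ u, mul_comm]

end Summit.HodgeConjecture.HodgeConjecture.Cruxes.H413.F0P2oThetaTypeJacquetWeightSpaceOfDictionary

end
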